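import Mathlib
import HarnessLib
import HarnessLib.Audit
import Summits.PneNP.Statement
import Literature.Computability.MetaComplexity.SumOfSquares
import Literature.Computability.MetaComplexity.ProofSystems
import Literature.Computability.MetaComplexity.ProofSystemsProofs
import Literature.Computability.Complexity.CookBridges
import Literature.Computability.Complexity.TautMachine
import HarnessLib.Audit.Status.Attr

/-!
Route: BruckRyserSos

# Route BruckRyserSos — designs that cannot exist, sums of squares that cannot see why —
Bruck–Ryser–Chowla tautologies as the SOS rung

It suffices to show X = "no Cook–Reckhow proof system is polynomially bounded on TAUT" (the shared
proof-complexity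
target stmt-PneNP-0097, kernel-checked equivalent to NP ≠ coNP, calibration C1). The route climbs
towards X on ONE new
explicit family of contradictions: the DESIGN EQUATIONS D(v,k,λ) — "A is a 0/1 v×v matrix with AAᵀ =
AᵀA = (k−λ)I + λJ" —
at parameters excluded by the Bruck–Ryser–Chowla theorem (projective planes of order n ≡ 1,2 (mod
4), n not a sum of two
squares: n = 6, 14, 21, 22, 30, 33, …) and by Schützenberger's determinant condition (v even, k − λ
not a square: the
biplanes (22,7,2), (46,10,2), …). The rung filed at open is Sum-of-Squares DEGREE: the O(v)-orbit of
real Gram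
factorisations fools degree 2 for EVERY admissible (v,k,λ) (support, provable now), and the cruxes
say the blindness
persists to every fixed degree (K1, K2) and to degree ε·v (K3). Realises card
PneNP/PneNP/designs-that-cannot-exist-sos-blind.
Lean: `¬ Literature.Computability.MetaComplexity.HasPolyBoundedProofSystem
Literature.Computability.Complexity.TAUT`

## Assembly
Pure logic, certified: `closes (hX : NoPolyBoundedProofSystem) : PneNP` is the conjecture-free
Cook–Reckhow bridge
already certified for route MatroidTseitin (P = NP ⇒ coNP = NP ⇒ TAUT ∈ NP ⇒ a p-bounded proof
system; CookBridges gives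
Cook's statement), re-proved verbatim in glue.lean over CookBridges/TautMachine/ProofSystemsProofs.
The SOS items are rungs
of the Cook–Reckhow ladder on the design family and are not hypotheses of `closes`; the Assembly
item below is the same
implication and is proved in Sketch.lean (assembly_proof := closes).

Rationale: WHY THIS LINE. Mechanism (card designs-that-cannot-exist-sos-blind): a propositional or
semialgebraic proof system reasons over one
completion of ℚ at a time — Sherali–Adams/SOS live over ℝ, where (k−λ)I + λJ ⪰ 0 IS a Gram matrix,
so the orbit
{P^(1/2)Q : Q ∈ O(v), Q𝟙 = 𝟙} satisfies every row/column-sum and every quadratic design identity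
EXACTLY and Booleanity on
average, and its moments are a degree-2 pseudoexpectation for every admissible (v,k,λ); the reason
the designs do not exist
is invisible over ℝ and visible only globally: det A² = k²(k−λ)^(v−1) forces k−λ to be a square when
v is even
(Schützenberger), and BψBᵀ = nψ makes two rational quadratic forms equivalent, whose Hasse–Minkowski
invariants (Hilbert
symbols at the primes p ∥ n, equivalently Lander's self-dual F_p-codes, doi:10.1017/cbo9780511662164
Thm 2.1, 2.5, 2.12, 2.18)
obstruct existence (doi:10.4153/CJM-1949-009-2). Imported: design theory and the arithmetic of
quadratic forms (BRC,
Legendre/Hasse–Minkowski, codes of designs) for the instance family and its dial of obstructions;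
real algebraic geometry /
SOS (pseudoexpectations arXiv:1701.04521 Defs 2.7–2.8; symmetry reduction and symmetric SOS lower
bounds: Grigoriev 2001
knapsack, Laurent doi:10.1287/moor.28.3.470.16391, Kurpisz–Leppänen–Mastrolilli
doi:10.1007/s10107-019-01398-9, Potechin
arXiv:1711.11469) for the engine. What no prior route does: every SOS/semialgebraic rung in the tree
(LatticeMagic: GapCVP
magic functions; RamseyUncertifiable: las(G)·las(Ḡ); DelsarteLasserre: margin-inexactness of
Lasserre on the Hamming scheme;
HeisenbergSparsestCut: metric gaps; Feige/RamseyThreshold: random instances) draws hardness from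
randomness, integrality of a
single sum, or parity; here the contradiction is a deterministic, rigid, S_v×S_v-symmetric system
whose only known refutation
is a local–global principle over ℚ — answering, on a non-CFI family, the call for SA/PC/SOS lower
bounds on rigid symmetric
formulas (Atserias, Oberwolfach Report 15/2024, open problem 10, doi:10.4171/OWR/2024/15). The dial
the route exposes —
counting (LP/SA) < reals (SOS) < mod-p linear algebra (PC_p / AC⁰[p]-Frege at p ∥ n, Lander's code
tier) < rational quadratic
forms (EF) — is itself new data for the Cook–Reckhow ladder. Negatives index: none of the five
refuted statements concerns
designs or SOS; the B2/B5 lessons (eventual quantification; witness quantified after the instance)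
are built into the typing.

RANKED CRUXES. #0 NoPolyBoundedProofSystem (crux) — X — no proof system for TAUT (tree
`HasPolyBoundedProofSystem TAUT`) is polynomially bounded; shared verbatim with routes
ExpanderLinearGenerators, AperiodicTorus, MatroidTseitin, LyapunovRefutations, LatticeMagic
(stmt-PneNP-0097). [difficulty: open-problem] (why it might fail: calibration C1: kernel-checked
equivalent to NP ≠ coNP (noPolyBoundedProofSystem_iff_NP_ne_coNP); no rung below aggregates to all
proof systems, and ¬X is consistent with every known lower bound.) [CookReckhow1979,
KrajicekProofComplexity2019, doi:10.4171/OWR/2024/15]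
#2 SosBlindPlanes (crux) — SOS CANNOT SEE HILBERT SYMBOLS (card K1, unbounded form): for every
degree d, for all sufficiently large n with n ≡ 1 or 2 (mod 4) and n not a sum of two squares (the
Bruck–Ryser-excluded plane orders), the design system of the putative projective plane of order n —
variables x_(p,B) = X(p·v+B), p,B < v = n²+n+1, identities Σ_B x_(p,B) = n+1, Σ_p x_(p,B) = n+1, Σ_B
x_(p,B)x_(p',B) = 1 (p ≠ p'), Σ_p x_(p,B)x_(p,B') = 1 (B ≠ B'), Booleanity x² = x — admits a
degree-d pseudoexpectation (tree IsPseudoexpectation/SatisfiesIdentity, KMOW Defs 2.7–2.8): degree-d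
SOS (hence degree-d Sherali–Adams) does not refute ¬PP(n). [difficulty: L] (why it might fail:
degree-4 SOS multiplies Booleanity by quadratics: a symmetrised low-degree consequence of
integrality (Σ_p(Σ_B c_B x_(p,B))² certificates mimicking the BRC descent, or a linearised
self-dual-code obstruction at a prime p ∥ n) may contradict the Gram identities at O(1) degree —
d(n)=O(1) at n=6.) [doi:10.4153/CJM-1949-009-2, doi:10.1017/cbo9780511662164, arXiv:1701.04521,
doi:10.1287/moor.28.3.470.16391, doi:10.1007/s10107-019-01398-9, arXiv:1711.11469]
#3 SosBlindEvenDesigns (crux) — THE DETERMINANT TIER (card K1, second clause): for every degree d,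
for all sufficiently large EVEN v and all (k,λ) with 0 < λ < k < v, λ(v−1) = k(k−1) and k−λ NOT a
perfect square (no symmetric design exists: det A² = k²(k−λ)^(v−1), Schützenberger 1949 /
Bruck–Ryser–Chowla part (i); infinite family: biplanes (22,7,2), (46,10,2), (92,14,2), …), the
design system D(v,k,λ) (identities with right-hand sides k, k, λ, λ) admits a degree-d
pseudoexpectation. [difficulty: L] (why it might fail: the determinant obstruction is 'just'
integrality of ONE symmetric polynomial value; aggregated 2×2-minor / Plücker-type identities under
S_v×S_v symmetry might expose non-squareness of k−λ at bounded degree, and the sparse biplane-type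
families may carry accidental low-degree structure.) [doi:10.4153/CJM-1949-009-2,
doi:10.1017/cbo9780511662164, arXiv:1701.04521, doi:10.1007/s10107-019-01398-9]
#4 SosBlindPlanesLinear (crux) — LINEAR-DEGREE BLINDNESS (card K1, conjectured strong form d(n) ≥
ε·v): there is ε > 0 such that for all large Bruck–Ryser-excluded n the plane system of order n
admits a pseudoexpectation of degree ⌊ε·(n²+n+1)⌋; implies SosBlindPlanes (checked in Sketch.lean)
and is the form that would make the family a genuine Lasserre-level benchmark (level Ω(v) on v²
variables). [deps: SosBlindPlanes] [difficulty: open-problem] (why it might fail: even granting K1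
the true growth may be log v or √v (planted clique: log; knapsack: linear) — nothing is known either
way; and degree εv on v² variables still yields no SOS SIZE bound via size–degree trade-offs (needs
ω(v·√log v)), so the rung is degree-only by design.) [arXiv:1701.04521,
doi:10.1287/moor.28.3.470.16391, arXiv:1811.01351, doi:10.1007/s10107-019-01398-9]
#9 DegreeTwoOrbitBlind (support) — THE ORTHOGONAL-ORBIT PSEUDOEXPECTATION (card P1, provable now):
for all (v,k,λ) with v ≥ 2, λ ≤ k ≤ v, λ(v−1) = k(k−1), the design system D(v,k,λ) admits a degree-2
pseudoexpectation — explicitly E[x_(p,B)] = E[x_(p,B)²] = k/v, E[x_(p,B)x_(p,B')] =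
E[x_(p,B)x_(p',B)] = k(k−1)/(v(v−1)), E[x_(p,B)x_(p',B')] = k(vk−2k+1)/(v(v−1)²) (p ≠ p', B ≠ B'),
extended by zero to higher monomials: the moments of Haar measure on {P^(1/2)Q : Q ∈ O(v), Q𝟙 = 𝟙},
P = (k−λ)I + λJ ⪰ 0 (eigenvalues k−λ and k²), which satisfies the identities exactly and Booleanity
cell-wise on average by column-exchangeability; PSD-ness of the (1+v²)-dimensional moment matrix
follows from its four S_v×S_v-isotypic eigenvalues. Corollary: no degree-2 SOS/SA refutation of
¬PP(6), ¬PP(10), ¬D(22,7,2). It is also the non-vacuity certificate of K1–K3 as typed (the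
identities are consistent at degree 2). [difficulty: provable-now] [doi:10.1017/cbo9780511662164,
arXiv:1701.04521, doi:10.1287/moor.28.3.470.16391]

TWO-LAYER PLAN. Foreseen glued splits (nothing filed now): SosBlindPlanes ⇐ DegreeFourPlanes (d = 4,
all large excluded n, by an explicit
symmetric degree-4 moment extension of the orbit moments) → SymmetricMomentExtension (a uniform d →
d+2 extension lemma for
S_v×S_v-invariant pseudo-moments of D(v,k,λ) indexed by bipartite multigraph types with ≤ d edges,
entries rational in
(v,k,λ)) → SosBlindPlanes; alternatively by arithmetic class of n: the 2-adic subfamily n ≡ 6 (mod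
8) (where a binary
self-dual doubly-even code argument also refutes, Lander Ch. 2) versus the odd-place subfamily (3 ∥
n, n ≡ 21, 33 mod 36).
Below SOS, once the CNF is defined: ResWidthPlanes (resolution width ≥ εn by a partial-plane
extension Delayer) and
Sherali–Adams rank, filed informally after open.

KILL CRITERIA. A refutation of SosBlindPlanes — a fixed degree d₀ at which SOS refutes ¬PP(n) for
infinitely many (let alone all large)
Bruck–Ryser-excluded n — closes the route `refuted:SosBlindPlanes` and is itself news ("SOS sees
Hasse–Minkowski"); the
engine card is then retired. A refutation of SosBlindEvenDesigns alone drops the determinant tier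
(route edit --drop) and
re-ranks; a refutation of SosBlindPlanesLinear with SosBlindPlanes standing drops K3 only (the
conjectured growth becomes
sublinear; restate with the proved rate if any). A refutation of DegreeTwoOrbitBlind can only be a
typing artefact of the
inline identities (repair by restating; the orbit computation is a two-line fact). ¬Target (= NP =
coNP) moots everything;
a proof of Target or of PneNP elsewhere moots the route.

NOT DECOMPOSED YET. No resolution / Sherali–Adams / polynomial-calculus / bounded-depth-Frege rung
is TYPED at open: they need the 3-CNF
`planeCNF n` (flag auxiliaries y_(p,p',B) ↔ x_(p,B) ∧ x_(p',B) chained to width 3) and a generic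
`HasSoSRefutation` /
SA-rank predicate — definition requests below; they are filed as informal statement items right
after open. The EF UPPER
bound (card K2: poly-size EF refutations of ¬PP(n) via the Gram identity, Lagrange's identity and
one polynomially bounded
rational linear solve; Hrubeš–Tzameret arXiv:1112.6265 for det multiplicativity in the even-v tier)
is filed informally as
support: it is what makes the family an EF-easy / SOS-hard separation candidate, not a step towards
X. The sporadic tier
(¬PP(10), Lam–Thiel–Swiercz doi:10.4153/CJM-1989-049-4; ¬PP(n) for non-prime-powers under the prime
power conjecture) is
deliberately NOT filed: one finite tautology per known n, conjecture-on-conjecture. Constants: none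
hand-picked (∃ ε in K3;
'eventually' in K1/K2).

CHEAPEST FALSIFIER. (i) Degree 2 by hand — done on paper (moments above; PSD by the isotypic
decomposition) and typed as DegreeTwoOrbitBlind;
(ii) the first real test, NOT run this session (compute-free hub; needs a
Gatermann–Parrilo/Terwilliger block-diagonalised
exact SDP, a kit job for the first refuter): feasibility of the symmetry-reduced degree-4 and
degree-6 Lasserre relaxation
of ¬PP(6) (v = 43, 1849 variables; blocks indexed by isomorphism types of bipartite multigraphs with
≤ 4 resp. ≤ 6 edges,
size independent of v) and of ¬D(22,7,2) — infeasibility at degree 4 kills K1/K2 on the spot; (iii)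
literature lookup
(done, see Novelty): no SOS/SA/PC/resolution bound for design or plane systems found in either
direction.

NUMBERS. Excluded plane orders (BRC): n ≡ 1,2 (mod 4) not a sum of two squares — 6, 14, 21, 22, 30,
33, 38, 42, 46, 54, 57, 62, …
(every n ≡ 6 mod 8 is excluded; Lander 1983 §2.1, PDF p. 58: "planes of order 6, 14, 21, 22, 30 or
33 cannot exist"). Determinant
tier: (v,k,λ) = (22,7,2), (46,10,2), (92,14,2) (λ(v−1) = k(k−1), v even, k−λ ∈ {5, 8, 12}). System
size: v² variables,
2v linear + v(v−1) quadratic identities; PP(6): v = 43, 1849 variables. Degree-2 moments: k/v,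
k(k−1)/(v(v−1)),
k(vk−2k+1)/(v(v−1)²). SOS conventions: KMOW arXiv:1701.04521 Defs 2.7–2.8 (tree SumOfSquares.lean).
Size–degree: SOS size S
⇒ degree O(√(N log S) + d₀) on N variables (Atserias–Hakoniemi arXiv:1811.01351), so degree εv on N
= v² variables gives no
size bound. Practice: the order-10 search needed ~2 years of CPU and multi-gigabyte SAT+CAS DRAT
certificates (Bright et al.
doi:10.1609/aaai.v35i5.16483); first open plane order 12.

DEFINITION REQUESTS. (1) `Literature.Computability.MetaComplexity.SumOfSquares`: `PolySystemSosBlind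
(d : ℕ) (S : Set (MvPolynomial ℕ ℝ)) :
Prop` (∃ degree-d pseudoexpectation satisfying Booleanity and every q ∈ S) and `designSystem (v k
lam : ℕ) : Set
(MvPolynomial ℕ ℝ)` — would shrink each item to one line; also wanted by routes DelsarteLasserre /
LatticeMagic /
HeisenbergSparsestCut (generic polynomial-system SOS). (2)
`Literature.Computability.Complexity.CNF`-side: `planeCNF (n : ℕ)
: CNF ℕ`, the width-3 encoding of "projective plane of order n on v = n²+n+1 points and lines"
(incidence x, flag
auxiliaries y, chain auxiliaries z), with `planeCNF_satisfiable_iff`. (3) Named facts for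
Literature/Combinatorics/Designs:
Bruck–Ryser–Chowla (doi:10.4153/CJM-1949-009-2; Chowla–Ryser 1950), Schützenberger's determinant
condition, Lam's theorem
(computer-assisted, doi:10.4153/CJM-1989-049-4) — none is a hypothesis of any filed item (blindness
statements do not need
non-existence), they document which members are contradictions.

Novelty: Searches (2026-08-16): `lit search --hybrid "sum of squares degree lower bound symmetric design
projective plane nonexistence"` (8 docs, all design-theory books: Hughes–Piper, Lander, Cameron–van
Lint, Brualdi–Ryser — no proof complexity); `lit search --hybrid "Bruck Ryser Chowla … Hasse
Minkowski"` (6 docs, same kind); `lit galaxy search "Bruck-Ryser" --star all` (16 rows: Assmus–Key,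
Lander, van Lint–Wilson ch. 19, Bright–Stevens–Kotsireas SAT+CAS slides on PP(10); no
SOS/SA/PC/Frege item); galaxy substring on "Bruck-Ryser sum of squares" / "projective plane of order
Lasserre" / "proof complexity projective plane" / "pseudoexpectation design" (0 rows each); `lit
read` Lander 1983 Ch. 2 (pp. 47–67: Thm 2.1 BRC via rational quadratic forms, Thm 2.5 Legendre form,
Thm 2.12/2.18 self-dual F_p-codes = BRC conditions (2),(3)); `lit galaxy read` Oberwolfach Report
15/2024 (open problems 1–11; Atserias #10 asks for non-CFI SA/SOS lower bounds on rigid symmetric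
formulas); `lit frontier PneNP --since 2023` (30 rows, none on designs); `ledger idea list` (171
PneNP cards: spine card graded new-combination by the critic; sporadic-designs-hadamard-uniformity =
tally existence bridge, graded variant, different statement); the 46 open route files' levers
(NOTES): no design/BRC/Hasse–Minkowski object anywhere; `ledger negatives` (5, none related); `lean
search` IsPseudoexpectation / SatisfiesIdentity / SOSFailsToRefute (tree SumOfSquares.lean, KMOW
conventions reused verbatim).
Nearest pri  [refs: 10.1287/moor.28.3.470.16391, 10.1007/s10107-019-01398-9, 10.1609/aaai.v35i5.16483, 10.1017/cbo9780511662164, 1711.11469, doi:10.1287/moor.28.3.470.16391, doi:10.1007/s10107-019-01398-9, doi:10.1609/aaai.v35i5.16483, doi:10.1017/cbo9780511662164]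

Barriers (technique_class: sos-lower-bounds, proof-complexity, symmetric-designs): - technique_class: sos-lower-bounds, proof-complexity, symmetric-designs
- Literature.Barriers.PneNP.FeasibleInterpolationEF: not touched — no EF LOWER bound is claimed (the
EF item is an upper bound); the rungs are SOS-degree statements proved by exhibiting
pseudoexpectations, not by interpolation.
- Literature.Barriers.PneNP.LowDegreeCounterexamples: the caution applies in spirit — SOS/low-degree
blindness says nothing about polynomial time (and here nothing is inferred about P: the summit is
reached only through the calibrated target); the rungs are proof-complexity statements about one
proof system.
- Literature.Barriers.PneNP.TSPExtensionComplexity: related technology (symmetric SDP lifts),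
different statement: we bound refutation DEGREE of an infeasible system, not extension complexity of
a polytope; Lee–Raghavendra–Steurer-type SDP lower bounds are an import, not an obstacle.
- Literature.Barriers.PneNP.NaturalProofs: not a circuit lower bound; no constructive/large property
of Boolean functions is used. it does not apply.
- Literature.Barriers.PneNP.Relativization: the TARGET (≡ NP ≠ coNP) cannot be proved by
relativizing means (NP^A = coNP^A for some A); the rungs are unrelativized finite statements about
explicit polynomial systems and do not pretend to aggregate — the bet is the Cook–Reckhow
programme's: lower bounds system by system on explicit families.
- Literature.Barriers.PneNP.Algebrization: same reading as Relativization for the target; it does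
not constrain

History (route lifecycle, newest last):
- 2026-08-16T20:50:43Z · rev 1: dropped stmt-PneNP-16803 — drop duplicate: EFProvesBruckRyser was filed twice by a planner retry (stmt-PneNP-16775 kept, stmt-PneNP-16803 dropped); not load-bearing — same informal suppor (planner-plan-novel-PneNP-PneNP-1b2e912a-v2-g7-0)
- 2026-08-25T06:32:51Z · DORMANT — reconciler: no traction for 7.5 d (last activity item-evidence-added at 2026-08-17T19:04:27Z); parked, not closed — `ledger route dormant route-PneNP-BruckRyser (operator:999:1788473)
- 2026-08-31T19:34:50Z · REACTIVATED (open) — reconciler: reactivated — activity statement-checked at 2026-08-31T18:52:19Z after parking at 2026-08-25T06:32:51Z (operator:999:829772)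

sub-problem: PneNP · status: open · opened planner-plan-novel-PneNP-PneNP-1b2e912a-v2-g7-0 2026-08-16T20:47:53Z · rev 1 · ledger route-PneNP-BruckRyserSos
GENERATED by the gate from the ledger (D-0016/17). Provers cite these decls: `theorem foo : Summit.PneNP.PneNP.Theses.BruckRyserSos.<Decl> := …` in Summits/PneNP/PneNP/Theorems/<Name>.lean.
-/

namespace Summit.PneNP.PneNP.Theses.BruckRyserSos

open scoped BigOperators Topology Manifold Classical MeasureTheory ProbabilityTheory Matrix InnerProductSpace ComplexConjugate ContinuousMap
open Filter Set Function TopologicalSpace MeasureTheory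

attribute [summit_statement] _root_.PneNP

open Literature.PNP

/-- item stmt-PneNP-0097 · crux · rank 0 · open · by planner
why it might fail: calibration C1: kernel-checked equivalent to NP ≠ coNP (noPolyBoundedProofSystem_iff_NP_ne_coNP); no rung below aggregates to all proof systems, and ¬X is consistent with every known lower bound.
sources: CookReckhow1979, KrajicekProofComplexity2019, doi:10.4171/OWR/2024/15
No Cook–Reckhow proof system for TAUT is polynomially bounded; equivalently NP ≠ coNP
[CookReckhow1979, Prop. 1.1]. Route thesis of PneNP/ProofCplx. [sources: CookReckhow1979;
arXiv:2208.11642] -/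
@[route_item "route-PneNP-BruckRyserSos", crux]
def NoPolyBoundedProofSystem : Prop :=
  ¬ Literature.Computability.MetaComplexity.HasPolyBoundedProofSystem Literature.Computability.Complexity.TAUT

/-- item stmt-PneNP-16761 · crux · rank 2 · closed · proved by Summit.PneNP.PneNP.Theorems.SosBlindPlanes.sosBlindPlanes_proof @ 22ffdc7fff8c (prover) · by planner
why it might fail: degree-4 SOS multiplies Booleanity by quadratics: a symmetrised low-degree consequence of integrality (Σ_p(Σ_B c_B x_(p,B))² certificates mimicking the BRC descent, or a linearised self-dual-code obstruction at a prime p ∥ n) may contradict the Gram identities at O(1) degree — d(n)=O(1) at n=6.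
sources: doi:10.4153/CJM-1949-009-2, doi:10.1017/cbo9780511662164, arXiv:1701.04521, doi:10.1287/moor.28.3.470.16391, doi:10.1007/s10107-019-01398-9, arXiv:1711.11469
[crux] SOS CANNOT SEE HILBERT SYMBOLS (card K1, unbounded form): for every degree d, for all
sufficiently large n with n ≡ 1 or 2 (mod 4) and n not a sum of two squares (the
Bruck–Ryser-excluded plane orders), the design system of the putative projective plane of order n —
variables x_(p,B) = X(p·v+B), p,B < v = n²+n+1, identities Σ_B x_(p,B) = n+1, Σ_p x_(p,B) = n+1, Σ_B
x_(p,B)x_(p',B) = 1 (p ≠ p'), Σ_p x_(p,B)x_(p,B') = 1 (B ≠ B'), Booleanity x² = x — admits a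
degree-d pseudoexpectation (tree IsPseudoexpectation/SatisfiesIdentity, KMOW Defs 2.7–2.8): degree-d
SOS (hence degree-d Sherali–Adams) does not refute ¬PP(n). [difficulty: L] -/
@[route_item "route-PneNP-BruckRyserSos"]
def SosBlindPlanes : Prop :=
  ∀ d : ℕ, ∃ N : ℕ, ∀ n ≥ N, (n % 4 = 1 ∨ n % 4 = 2) → (¬ ∃ a b : ℕ, a ^ 2 + b ^ 2 = n) → ∃ E : MvPolynomial ℕ ℝ →ₗ[ℝ] ℝ, Literature.Computability.MetaComplexity.IsPseudoexpectation d E ∧ (∀ w : ℕ, Literature.Computability.MetaComplexity.SatisfiesIdentity d E (Literature.Computability.MetaComplexity.boolAxiom w)) ∧ (∀ p < n ^ 2 + n + 1, Literature.Computability.MetaComplexity.SatisfiesIdentity d E ((∑ B ∈ Finset.range (n ^ 2 + n + 1), MvPolynomial.X (p * (n ^ 2 + n + 1) + B)) - MvPolynomial.C ((n + 1 : ℕ) : ℝ))) ∧ (∀ B < n ^ 2 + n + 1, Literature.Computability.MetaComplexity.SatisfiesIdentity d E ((∑ p ∈ Finset.range (n ^ 2 + n + 1), MvPolynomial.X (p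 * (n ^ 2 + n + 1) + B)) - MvPolynomial.C ((n + 1 : ℕ) : ℝ))) ∧ (∀ p < n ^ 2 + n + 1, ∀ p' < n ^ 2 + n + 1, p ≠ p' → Literature.Computability.MetaComplexity.SatisfiesIdentity d E ((∑ B ∈ Finset.range (n ^ 2 + n + 1), MvPolynomial.X (p * (n ^ 2 + n + 1) + B) * MvPolynomial.X (p' * (n ^ 2 + n + 1) + B)) - MvPolynomial.C (1 : ℝ))) ∧ (∀ B < n ^ 2 + n + 1, ∀ B' < n ^ 2 + n + 1, B ≠ B' → Literature.Computability.MetaComplexity.SatisfiesIdentity d E ((∑ p ∈ Finset.range (n ^ 2 + n + 1), MvPolynomial.X (p * (n ^ 2 + n + 1) + B) * MvPolynomial.X (p * (n ^ 2 + n + 1) + B')) - MvPolynomial.C (1 : ℝ)))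

-- `SosBlindPlanes` holds: proved by `Summit.PneNP.PneNP.Theorems.SosBlindPlanes.sosBlindPlanes_proof` @ 22ffdc7fff8c (its module imports this route file, so no `_holds` link can be stated here).

/-- item stmt-PneNP-16762 · crux · rank 3 · open · by planner
why it might fail: the determinant obstruction is 'just' integrality of ONE symmetric polynomial value; aggregated 2×2-minor / Plücker-type identities under S_v×S_v symmetry might expose non-squareness of k−λ at bounded degree, and the sparse biplane-type families may carry accidental low-degree structure.
sources: doi:10.4153/CJM-1949-009-2, doi:10.1017/cbo9780511662164, arXiv:1701.04521, doi:10.1007/s10107-019-01398-9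
[crux] THE DETERMINANT TIER (card K1, second clause): for every degree d, for all sufficiently large
EVEN v and all (k,λ) with 0 < λ < k < v, λ(v−1) = k(k−1) and k−λ NOT a perfect square (no symmetric
design exists: det A² = k²(k−λ)^(v−1), Schützenberger 1949 / Bruck–Ryser–Chowla part (i); infinite
family: biplanes (22,7,2), (46,10,2), (92,14,2), …), the design system D(v,k,λ) (identities with
right-hand sides k, k, λ, λ) admits a degree-d pseudoexpectation. [difficulty: L] -/
@[route_item "route-PneNP-BruckRyserSos"]
def SosBlindEvenDesigns : Prop :=
  ∀ d : ℕ, ∃ V : ℕ, ∀ v ≥ V, ∀ k lam : ℕ, Even v → 0 < lam → lam < k → k < v → lam * (v - 1) = k * (k - 1) → ¬ IsSquare (k - lam) → ∃ E : MvPolynomial ℕ ℝ →ₗ[ℝ] ℝ, Literature.Computability.MetaComplexity.IsPseudoexpectation d E ∧ (∀ w : ℕ, Literature.Computability.MetaComplexity.SatisfiesIdentity d E (Literature.Computability.MetaComplexity.boolAxiom w)) ∧ (∀ p < v, Literature.Computability.MetaComplexity.SatisfiesIdentity d E ((∑ B ∈ Finset.range v, MvPolynomial.X (p * v + B)) - MvPolynomial.C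 (k : ℝ))) ∧ (∀ B < v, Literature.Computability.MetaComplexity.SatisfiesIdentity d E ((∑ p ∈ Finset.range v, MvPolynomial.X (p * v + B)) - MvPolynomial.C (k : ℝ))) ∧ (∀ p < v, ∀ p' < v, p ≠ p' → Literature.Computability.MetaComplexity.SatisfiesIdentity d E ((∑ B ∈ Finset.range v, MvPolynomial.X (p * v + B) * MvPolynomial.X (p' * v + B)) - MvPolynomial.C (lam : ℝ))) ∧ (∀ B < v, ∀ B' < v, B ≠ B' → Literature.Computability.MetaComplexity.SatisfiesIdentity d E ((∑ p ∈ Finset.range v, MvPolynomial.X (p * v + B) * MvPolynomial.X (p * v + B')) - MvPolynomial.C (lam : ℝ)))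

/-- item stmt-PneNP-16763 · crux · rank 4 · open · by planner
why it might fail: even granting K1 the true growth may be log v or √v (planted clique: log; knapsack: linear) — nothing is known either way; and degree εv on v² variables still yields no SOS SIZE bound via size–degree trade-offs (needs ω(v·√log v)), so the rung is degree-only by design.
sources: arXiv:1701.04521, doi:10.1287/moor.28.3.470.16391, arXiv:1811.01351, doi:10.1007/s10107-019-01398-9
[crux] LINEAR-DEGREE BLINDNESS (card K1, conjectured strong form d(n) ≥ ε·v): there is ε > 0 such
that for all large Bruck–Ryser-excluded n the plane system of order n admits a pseudoexpectation of
degree ⌊ε·(n²+n+1)⌋; implies SosBlindPlanes (checked in Sketch.lean) and is the form that would make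
the family a genuine Lasserre-level benchmark (level Ω(v) on v² variables). [deps: SosBlindPlanes]
[difficulty: open-problem] -/
@[route_item "route-PneNP-BruckRyserSos"]
def SosBlindPlanesLinear : Prop :=
  ∃ ε : ℝ, 0 < ε ∧ ∃ N : ℕ, ∀ n ≥ N, (n % 4 = 1 ∨ n % 4 = 2) → (¬ ∃ a b : ℕ, a ^ 2 + b ^ 2 = n) → ∃ E : MvPolynomial ℕ ℝ →ₗ[ℝ] ℝ, Literature.Computability.MetaComplexity.IsPseudoexpectation ⌊ε * ((n ^ 2 + n + 1 : ℕ) : ℝ)⌋₊ E ∧ (∀ w : ℕ, Literature.Computability.MetaComplexity.SatisfiesIdentity ⌊ε * ((n ^ 2 + n + 1 : ℕ) : ℝ)⌋₊ E (Literature.Computability.MetaComplexity.boolAxiom w)) ∧ (∀ p < n ^ 2 + n + 1, Literature.Computability.MetaComplexity.SatisfiesIdentity ⌊ε * ((n ^ 2 + n + 1 : ℕ) : ℝ)⌋₊ E ((∑ B ∈ Finset.range (n ^ 2 + n + 1), MvPolynomial.X (p * (n ^ 2 + n + 1) + B)) - MvPolynomial.C ((n + 1 : ℕ) : ℝ)))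 ∧ (∀ B < n ^ 2 + n + 1, Literature.Computability.MetaComplexity.SatisfiesIdentity ⌊ε * ((n ^ 2 + n + 1 : ℕ) : ℝ)⌋₊ E ((∑ p ∈ Finset.range (n ^ 2 + n + 1), MvPolynomial.X (p * (n ^ 2 + n + 1) + B)) - MvPolynomial.C ((n + 1 : ℕ) : ℝ))) ∧ (∀ p < n ^ 2 + n + 1, ∀ p' < n ^ 2 + n + 1, p ≠ p' → Literature.Computability.MetaComplexity.SatisfiesIdentity ⌊ε * ((n ^ 2 + n + 1 : ℕ) : ℝ)⌋₊ E ((∑ B ∈ Finset.range (n ^ 2 + n + 1), MvPolynomial.X (p * (n ^ 2 + n + 1) + B) * MvPolynomial.X (p' * (n ^ 2 + n + 1) + B)) - MvPolynomial.C (1 : ℝ))) ∧ (∀ B < n ^ 2 + n + 1, ∀ B' < n ^ 2 + n + 1, B ≠ B' → Literature.Computability.MetaComplexity.SatisfiesIdentity ⌊ε * ((n ^ 2 + n + 1 : ℕ) : ℝ)⌋₊ E ((∑ p ∈ Finset.range (n ^ 2 + n + 1), MvPolynomial.X (p * (n ^ 2 + n + 1) + B) * MvPolynomial.X (p * (n ^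 2 + n + 1) + B')) - MvPolynomial.C (1 : ℝ)))

-- item stmt-PneNP-16767 · support · rank 5 · open · by planner — informal only, no Lean statement yet:
--   [crux] BELOW SOS — RESOLUTION WIDTH OF THE PLANE CNF (card K3): there is ε > 0 such that for all
--   large n every resolution refutation of planeCNF n (the width-3 CNF "a projective plane of order n on
--   v = n²+n+1 points and v lines exists": incidence variables x_(p,B); flag auxiliaries y_(p,p′,B) ↔
--   x_(p,B) ∧ x_(p′,B) and their duals; "every two points share a line" / "every two lines share a
--   point" as width-3 chains over fresh z; "no two points on two common lines" as 4-clauses; every point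
--   on ≥ 3 lines and every line through ≥ 3 points) has width ≥ ε·n, hence tree-like size 2^{Ω(n)}
--   (resWidth / I

/-- item stmt-PneNP-16764 · support · rank 9 · closed · proved by Summit.PneNP.PneNP.Theorems.degreeTwoOrbitBlind_proof @ e67f7681d4d8 (prover) · by planner
sources: doi:10.1017/cbo9780511662164, arXiv:1701.04521, doi:10.1287/moor.28.3.470.16391
[support] THE ORTHOGONAL-ORBIT PSEUDOEXPECTATION (card P1, provable now): for all (v,k,λ) with v ≥
2, λ ≤ k ≤ v, λ(v−1) = k(k−1), the design system D(v,k,λ) admits a degree-2 pseudoexpectation —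
explicitly E[x_(p,B)] = E[x_(p,B)²] = k/v, E[x_(p,B)x_(p,B')] = E[x_(p,B)x_(p',B)] =
k(k−1)/(v(v−1)), E[x_(p,B)x_(p',B')] = k(vk−2k+1)/(v(v−1)²) (p ≠ p', B ≠ B'), extended by zero to
higher monomials: the moments of Haar measure on {P^(1/2)Q : Q ∈ O(v), Q𝟙 = 𝟙}, P = (k−λ)I + λJ ⪰ 0
(eigenvalues k−λ and k²), which satisfies the identities exactly and Booleanity cell-wise on average
by column-exchangeability; PSD-ness of the (1+v²)-dimensional moment matrix follows from its four
S_v×S_v-isotypic eigenvalues. Corollary: no degree-2 SOS/SA refutation of ¬PP(6), ¬PP(10),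
¬D(22,7,2). It is also the non-vacuity certificate of K1–K3 as typed (the identities are consistent
at degree 2). [difficulty: provable-now] -/
@[route_item "route-PneNP-BruckRyserSos"]
def DegreeTwoOrbitBlind : Prop :=
  ∀ v k lam : ℕ, 2 ≤ v → lam ≤ k → k ≤ v → lam * (v - 1) = k * (k - 1) → ∃ E : MvPolynomial ℕ ℝ →ₗ[ℝ] ℝ, Literature.Computability.MetaComplexity.IsPseudoexpectation 2 E ∧ (∀ w : ℕ, Literature.Computability.MetaComplexity.SatisfiesIdentity 2 E (Literature.Computability.MetaComplexity.boolAxiom w)) ∧ (∀ p < v, Literature.Computability.MetaComplexity.SatisfiesIdentity 2 E ((∑ B ∈ Finset.range v, MvPolynomial.X (p * v + B)) - MvPolynomial.C (k : ℝ))) ∧ (∀ B < v, Literature.Computability.MetaComplexity.SatisfiesIdentity 2 E ((∑ p ∈ Finset.range v, MvPolynomial.X (p * v + B)) - MvPolynomial.C (k : ℝ))) ∧ (∀ p < v, ∀ p' < v, p ≠ p' → Literature.Computability.MetaComplexity.SatisfiesIdentity 2 E ((∑ B ∈ Finset.range v, MvPolynomial.X (p * v + B) * MvPolynomial.X (p'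 * v + B)) - MvPolynomial.C (lam : ℝ))) ∧ (∀ B < v, ∀ B' < v, B ≠ B' → Literature.Computability.MetaComplexity.SatisfiesIdentity 2 E ((∑ p ∈ Finset.range v, MvPolynomial.X (p * v + B) * MvPolynomial.X (p * v + B')) - MvPolynomial.C (lam : ℝ)))

-- `DegreeTwoOrbitBlind` holds: proved by `Summit.PneNP.PneNP.Theorems.degreeTwoOrbitBlind_proof` @ e67f7681d4d8 (its module imports this route file, so no `_holds` link can be stated here).

-- item stmt-PneNP-16775 · support · rank 9 · open · by planner — informal only, no Lean statement yet:
--   [support] THE ARITHMETIC IS FEASIBLE FOR EF (card K2; an UPPER bound, not a step towards X — it is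
--   what would make the family an explicit SOS-hard / EF-easy separation): polynomial-size Extended
--   Frege refutations of ¬PP(n) (propositional translation of the plane system / planeCNF n) for all
--   Bruck–Ryser-excluded n, by formalising Lander Thm 2.1 inside EF: the Gram identity BψBᵀ = nψ for the
--   extended incidence matrix, Lagrange four-square identity, Witt cancellation as v successive rational
--   specialisations collected into ONE polynomially bounded linear solve, and the two-squares criterion
--   for th

/-- item stmt-PneNP-16765 · assembly · rank 1 · closed · proved by Summit.PneNP.PneNP.Theorems.bruckRyserSos_assembly_proof @ bea114153da3 (prover) · by planner
sources: CookReckhow1979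
[assembly] NoPolyBoundedProofSystem → PneNP. -/
@[route_item "route-PneNP-BruckRyserSos"]
def Assembly : Prop :=
  NoPolyBoundedProofSystem → _root_.PneNP

-- `Assembly` holds: proved by `Summit.PneNP.PneNP.Theorems.bruckRyserSos_assembly_proof` @ bea114153da3 (its module imports this route file, so no `_holds` link can be stated here).

/-! D-0027 §2.1 — DECIDING THEOREM (planner-authored via `route open/edit --closes-file`; by planner-plan-novel-PneNP-PneNP-1b2e912a-v2-g7-0 2026-08-16T20:47:53Z):
its hypotheses are this route's items and its conclusion the sub-problem Statement (glue_lint), and it elaborates with this file. -/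

@[closes "route-PneNP-BruckRyserSos"] theorem closes (hX : NoPolyBoundedProofSystem) : _root_.PneNP := by
  -- Cook–Reckhow + the Cook/Wave0 model bridges (conjecture-free modules CookBridges, TautMachine,
  -- ProofSystemsProofs, Classes): if Classes.P = NP then coNP = co P = P = NP (co_P_holds), so TAUT ∈ coNP
  -- (TAUT_mem_coNP_holds) lies in NP and has a polynomially bounded proof system
  -- (hasPolyBoundedProofSystem_iff_mem_NP_holds), contradicting X; Classes.P ≠ NP is Cook's statement by
  -- CookBridges (pneNP_shape_of_P_ne_NP). (Same certified glue as route MatroidTseitin.)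
  have hne : Literature.Computability.Complexity.Classes.P ≠
      Literature.Computability.Complexity.Nondeterministic.NP := by
    intro hPNP
    apply hX
    have hT : Literature.Computability.Complexity.TAUT ∈ Literature.Computability.Complexity.coNP :=
      Literature.Computability.Complexity.TAUT_mem_coNP_holds
    have hco : Literature.Computability.Complexity.coNP =
        Literature.Computability.Complexity.Nondeterministic.NP := by
      show Literature.Computability.Complexity.co Literature.Computability.Complexity.Nondeterministic.NP =
        Literature.Computability.Complexity.Nondeterministic.NP
      rw [← hPNP]
      exact Literature.Computability.Complexity.co_P_holds
    rw [hco] at hT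
    exact Literature.Computability.MetaComplexity.hasPolyBoundedProofSystem_iff_mem_NP_holds.2 hT
  obtain ⟨L, hL, hL'⟩ := Literature.Computability.Complexity.pneNP_shape_of_P_ne_NP hne
  exact ⟨L, hL, hL'⟩

end Summit.PneNP.PneNP.Theses.BruckRyserSos
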